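import Mathlib
import Literature.Analysis.FluidPDE.Tao2016AveragedNS.ShiftSetCascadeFlows
import Literature.Analysis.FluidPDE.Tao2016AveragedNS.ShiftSetCascadeFlux
import Summits.NavierStokesRegularity.NavierStokesRegularity.Theorems.TaoLadderRungTwoFlatQuadPolarOn
import Summits.NavierStokesRegularity.NavierStokesRegularity.Theorems.TaoLadderRungTwoFlatLinearisedUniqueness
import Summits.NavierStokesRegularity.NavierStokesRegularity.Theorems.TaoLadderRungTwoFlatForcedGronwall
import Summits.NavierStokesRegularity.NavierStokesRegularity.Theorems.TaoLadderRungTwoFlatVariationalExistence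
import Summits.NavierStokesRegularity.NavierStokesRegularity.Theorems.TaoLadderRungTwoFlatHomogeneousL2Field
import Summits.NavierStokesRegularity.NavierStokesRegularity.Theorems.TaoLadderRungTwoFlatGaugeGronwall
import Summits.NavierStokesRegularity.NavierStokesRegularity.Theorems.TaoLadderRungTwoFlatNonlinearHop
import Summits.NavierStokesRegularity.NavierStokesRegularity.Theorems.TaoLadderRungTwoFlatGaugeGronwallOn
import HarnessLib

/-!
# LINEAR ⇒ NONLINEAR HOP ESTIMATE ON A TIME WINDOW `[0, T]` (window data; read-out at any `T_r ∈ [0, T]`)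
  (helper for item stmt-NavierStokesRegularity-22987 `FlatGapCertificatesV2`, crux K_A♭ of route TaoLadderRungTwoFlat;
  cell harvest/h2-tao-ladder, p1 g20 — window version of `…NonlinearHop`, for graded-lattice certificate flows which exist
  only on windows)

Same content as `…NonlinearHop.gauge_linearisation_error` / `nonlinear_hop_estimate`, with the hypotheses a window flow
provides: amplitudes continuous on `Icc 0 T`, `HasDerivAt` on `Ioo 0 T`, bounds on `Icc 0 T`. The variational solution
along the window reference `W` is produced by extending `W` to all times by CLAMPING (`clampFam T W`, bounded and
Lipschitz, equal to `W` on the window) and running the tree's global linear existence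
(`…VariationalExistence.exists_linearised_solution`) along the extension:

* `clampTime`, `clampFam` (+ `clampFam_eq`, bounds, Lipschitz); `lipschitzOn_of_windowSol` (MVT: a window solution is
  `‖α‖₁M²`-Lipschitz on `[0, T]`);
* `gauge_linearisation_error_Icc` — `w|X − W − u|(s) ≤ ‖α‖₁A(B̃e^{L'T})²se^{L's}` on `[0, T]`;
* `nonlinear_hop_estimate_Icc` — the (S2)-shape hypothesis over WINDOW variational solutions (continuous on `Icc 0 T`,
  `HasDerivAt` on `Ioo 0 T`, sup-bounded), read out at `T_r ∈ [0, T]`, transfers to the nonlinear deviation with the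
  remainder `Γ‖α‖₁A(B̃e^{L'T})²T_re^{L'T_r}`.

HONEST FRAMING: elementary perturbation theory for MODEL lattices; nothing certified; nothing about the Navier–Stokes
equations.
-/

noncomputable section

-- the sub-problem namespace repeats the summit name by design (D-0017)
set_option linter.dupNamespace false

namespace Summit.NavierStokesRegularity.NavierStokesRegularity.Theorems

open Set Filter Literature.Analysis.FluidPDE Literature.Analysis.FluidPDE.TaoCascade
open scoped Topology Nat

namespace QuadPolar

variable {m : ℕ}

/-! ### Clamping a window family to all times -/

/-- Clamp a time to the window `[0, T]`. [folklore] -/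
def clampTime (T t : ℝ) : ℝ := max (min t T) 0

/-- The clamped time lies in the window (`T ≥ 0`). [folklore] -/
theorem clampTime_mem {T : ℝ} (hT : 0 ≤ T) (t : ℝ) : clampTime T t ∈ Icc 0 T :=
  ⟨le_max_right _ _, max_le (min_le_right _ _) hT⟩

/-- Inside the window the clamp is the identity. [folklore] -/
theorem clampTime_of_mem {T t : ℝ} (ht : t ∈ Icc 0 T) : clampTime T t = t := by
  unfold clampTime; rw [min_eq_left ht.2, max_eq_left ht.1]

/-- The clamp is `1`-Lipschitz. [folklore] -/
theorem abs_clampTime_sub_le (T t s : ℝ) : |clampTime T t - clampTime T s| ≤ |t - s| := by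
  unfold clampTime
  calc |max (min t T) 0 - max (min s T) 0| ≤ |min t T - min s T| := abs_max_sub_max_le_abs _ _ _
    _ ≤ max |t - s| |T - T| := abs_min_sub_min_le_max _ _ _ _
    _ = |t - s| := by simp

/-- A window family extended to all times by clamping the time argument. [folklore] -/
def clampFam (T : ℝ) (W : Fin m → ℤ → ℝ → ℝ) : Fin m → ℤ → ℝ → ℝ := fun j k t => W j k (clampTime T t)

/-- On the window the clamped family is the family. [folklore] -/
theorem clampFam_eq {T : ℝ} (W : Fin m → ℤ → ℝ → ℝ) {t : ℝ} (ht : t ∈ Icc 0 T) (j : Fin m) (k : ℤ) :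
    clampFam T W j k t = W j k t := by
  simp only [clampFam, clampTime_of_mem ht]

/-- The clamped family inherits the window bound. [folklore] -/
theorem abs_clampFam_le {T M : ℝ} (hT : 0 ≤ T) {W : Fin m → ℤ → ℝ → ℝ} (hWb : ∀ j k, ∀ t ∈ Icc 0 T, |W j k t| ≤ M)
    (j : Fin m) (k : ℤ) (t : ℝ) : |clampFam T W j k t| ≤ M :=
  hWb j k _ (clampTime_mem hT t)

/-- **A window solution is Lipschitz in time** (mean value theorem with `|Ẇ| = |Q(W)| ≤ ‖α‖₁M²` inside the window).
[cite: Tao2016AveragedNS, §4 (4.8); folklore] -/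
theorem lipschitzOn_of_windowSol (𝕊 : Finset (ℤ × ℤ × ℤ)) (α : Fin m → Fin m → Fin m → ℤ × ℤ × ℤ → ℝ)
    {W : Fin m → ℤ → ℝ → ℝ} {M T : ℝ} (hWc : ∀ j k, ContinuousOn (W j k) (Icc 0 T))
    (hW : ∀ j k, ∀ t ∈ Ioo 0 T, HasDerivAt (W j k) (quadTermOn 𝕊 0 α W j k t) t)
    (hWb : ∀ j k, ∀ t ∈ Icc 0 T, |W j k t| ≤ M) (j : Fin m) (k : ℤ) {t s : ℝ} (ht : t ∈ Icc 0 T)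
    (hs : s ∈ Icc 0 T) : |W j k t - W j k s| ≤ tableAbsSum 𝕊 α * M ^ 2 * |t - s| := by
  -- reduce to s < t by symmetry
  wlog hst : s < t generalizing s t
  · rcases eq_or_lt_of_le (not_lt.mp hst) with h | h
    · rw [h]; simp
    · have h' := this hs ht h
      rw [abs_sub_comm (W j k s) (W j k t), abs_sub_comm s t] at h'
      exact h'
  obtain ⟨c, hc, hceq⟩ := exists_hasDerivAt_eq_slope (W j k) (fun x => quadTermOn 𝕊 0 α W j k x) hst
    ((hWc j k).mono (Icc_subset_Icc hs.1 ht.2)) (fun x hx => hW j k x ⟨hs.1.trans_lt hx.1, hx.2.trans_le ht.2⟩)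
  have hcI : c ∈ Icc 0 T := ⟨hs.1.trans hc.1.le, hc.2.le.trans ht.2⟩
  have hQ : |quadTermOn 𝕊 0 α W j k c| ≤ tableAbsSum 𝕊 α * M ^ 2 :=
    abs_quadTermOn_zero_le_tableAbsSum 𝕊 α (fun j' k' => hWb j' k' c hcI) j k
  have hts : 0 < t - s := by linarith
  have e : W j k t - W j k s = quadTermOn 𝕊 0 α W j k c * (t - s) := by
    rw [hceq]; field_simp
  rw [e, abs_mul]
  exact mul_le_mul_of_nonneg_right hQ (abs_nonneg _)

/-- The clamped extension of a window solution is globally Lipschitz with the same constant. [folklore] -/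
theorem abs_clampFam_sub_le (𝕊 : Finset (ℤ × ℤ × ℤ)) (α : Fin m → Fin m → Fin m → ℤ × ℤ × ℤ → ℝ)
    {W : Fin m → ℤ → ℝ → ℝ} {M T : ℝ} (hT : 0 ≤ T) (hWc : ∀ j k, ContinuousOn (W j k) (Icc 0 T))
    (hW : ∀ j k, ∀ t ∈ Ioo 0 T, HasDerivAt (W j k) (quadTermOn 𝕊 0 α W j k t) t)
    (hWb : ∀ j k, ∀ t ∈ Icc 0 T, |W j k t| ≤ M) (j : Fin m) (k : ℤ) (t s : ℝ) :
    |clampFam T W j k t - clampFam T W j k s| ≤ tableAbsSum 𝕊 α * M ^ 2 * |t - s| := by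
  unfold clampFam
  have h := lipschitzOn_of_windowSol 𝕊 α hWc hW hWb j k (clampTime_mem hT t) (clampTime_mem hT s)
  refine h.trans (mul_le_mul_of_nonneg_left (abs_clampTime_sub_le T t s) ?_)
  have := tableAbsSum_nonneg 𝕊 α; positivity

/-- **A variational solution along a window reference from given data**: for a window solution `W` on `[0, T]` and bounded
data `v` there is `u`, continuous everywhere, with `u(0) = v`, solving `u̇ = Lin_W(u)` at every interior time of the window,
and sup-bounded on `[0, T]` (global existence along the clamped extension of `W`).
[cite: Teschl2012, Cor. 2.16; Tao2016AveragedNS, §4 (4.8)] -/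
theorem exists_variational_on_window (𝕊 : Finset (ℤ × ℤ × ℤ)) (α : Fin m → Fin m → Fin m → ℤ × ℤ × ℤ → ℝ)
    {W : Fin m → ℤ → ℝ → ℝ} {M T B₀ : ℝ} (hT : 0 ≤ T) (hWc : ∀ j k, ContinuousOn (W j k) (Icc 0 T))
    (hW : ∀ j k, ∀ t ∈ Ioo 0 T, HasDerivAt (W j k) (quadTermOn 𝕊 0 α W j k t) t)
    (hWb : ∀ j k, ∀ t ∈ Icc 0 T, |W j k t| ≤ M) {v : Fin m → ℤ → ℝ} (hv : ∀ i k, |v i k| ≤ B₀) :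
    ∃ u : Fin m → ℤ → ℝ → ℝ, (∀ i k, u i k 0 = v i k) ∧ (∀ i k, Continuous (u i k)) ∧
      (∀ i k, ∀ t ∈ Ioo 0 T, HasDerivAt (u i k) (linTermOn 𝕊 0 α W u i k t) t) ∧
      ∃ Mu : ℝ, ∀ i k, ∀ t ∈ Icc 0 T, |u i k t| ≤ Mu := by
  have hM0 : 0 ≤ max M 0 := le_max_right _ _
  have hWbm : ∀ j k, ∀ t ∈ Icc 0 T, |W j k t| ≤ max M 0 := fun j k t ht => (hWb j k t ht).trans (le_max_left _ _)
  have hcb : ∀ j k t, |clampFam T W j k t| ≤ max M 0 := abs_clampFam_le hT hWbm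
  have hclip := abs_clampFam_sub_le 𝕊 α hT hWc hW hWbm
  have hΛ : 0 ≤ tableAbsSum 𝕊 α * (max M 0) ^ 2 := by have := tableAbsSum_nonneg 𝕊 α; positivity
  obtain ⟨u, hu0, hud, hub⟩ := exists_linearised_solution 𝕊 α hcb hM0 hΛ hclip hv
  refine ⟨u, hu0, fun i k => continuous_iff_continuousAt.2 fun t => (hud i k t).continuousAt, fun i k t ht => ?_,
    ⟨_, fun i k t ht => hub T hT i k t ⟨by linarith [ht.1], ht.2⟩⟩⟩
  have h := hud i k t
  have htI : t ∈ Icc 0 T := ⟨ht.1.le, ht.2.le⟩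
  have e : linTermOn 𝕊 0 α (clampFam T W) u i k t = linTermOn 𝕊 0 α W u i k t := by
    unfold linTermOn
    rw [MirrorPulse.bilinOn_congr_time 𝕊 0 α (X := clampFam T W) (X' := W) (Y := u) (Y' := u) (t := t)
        (fun j l => clampFam_eq W htI j l) (fun _ _ => rfl) i k,
      MirrorPulse.bilinOn_congr_time 𝕊 0 α (X := u) (X' := u) (Y := clampFam T W) (Y' := W) (t := t)
        (fun _ _ => rfl) (fun j l => clampFam_eq W htI j l) i k]
  rwa [e] at h

/-! ### Linearisation error on a window -/

/-- **GAUGE LINEARISATION ERROR ON A WINDOW**: window solutions `W`, `X` on `[0, T]` bounded by `M`; `u` a window variational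
solution along `W` from `X(0) − W(0)`, continuous on the window, sup-bounded; gauge `w` window-regular (`Λ`) and
window-admissible (`A`); `w|X(0) − W(0)| ≤ B̃`. Then `w|X − W − u|(s) ≤ ‖α‖₁A(B̃e^{L'T})²se^{L's}` on `[0, T]`.
[cite: Tao2016AveragedNS, §4 (4.8); folklore (Duhamel–Gronwall)] -/
theorem gauge_linearisation_error_Icc {𝕊 : Finset (ℤ × ℤ × ℤ)} (h𝕊 : IsNearestNeighbourSet 𝕊)
    (α : Fin m → Fin m → Fin m → ℤ × ℤ × ℤ → ℝ) {w : Fin m → ℤ → ℝ} {Λ A : ℝ} (hw : IsWindowRegular w Λ)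
    (hA : IsWindowAdmissible w A) {W X u : Fin m → ℤ → ℝ → ℝ} {M Mu B T : ℝ}
    (hWc : ∀ i n, ContinuousOn (W i n) (Icc 0 T)) (hXc : ∀ i n, ContinuousOn (X i n) (Icc 0 T))
    (hW : ∀ i n, ∀ t ∈ Ioo 0 T, HasDerivAt (W i n) (quadTermOn 𝕊 0 α W i n t) t)
    (hX : ∀ i n, ∀ t ∈ Ioo 0 T, HasDerivAt (X i n) (quadTermOn 𝕊 0 α X i n t) t)
    (hWb : ∀ i n, ∀ t ∈ Icc 0 T, |W i n t| ≤ M) (hXb : ∀ i n, ∀ t ∈ Icc 0 T, |X i n t| ≤ M)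
    (huc : ∀ i n, ContinuousOn (u i n) (Icc 0 T))
    (hu : ∀ i n, ∀ t ∈ Ioo 0 T, HasDerivAt (u i n) (linTermOn 𝕊 0 α W u i n t) t)
    (hub : ∀ i n, ∀ t ∈ Icc 0 T, |u i n t| ≤ Mu) (hu0 : ∀ i n, u i n 0 = X i n 0 - W i n 0)
    (hB : ∀ i n, w i n * |X i n 0 - W i n 0| ≤ B) (i : Fin m) (n : ℤ) {s : ℝ} (hs : s ∈ Icc 0 T) :
    w i n * |X i n s - W i n s - u i n s| ≤
      tableAbsSum 𝕊 α * A * (B * Real.exp (2 * tableAbsSum 𝕊 α * M * Λ * T)) ^ 2 * s *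
        Real.exp (2 * tableAbsSum 𝕊 α * M * Λ * s) := by
  set η : Fin m → ℤ → ℝ → ℝ := X - W with hη
  set ζ : Fin m → ℤ → ℝ → ℝ := fun j k t => η j k t - u j k t with hζ
  set f : Fin m → ℤ → ℝ → ℝ := fun j k t => quadTermOn 𝕊 0 α η j k t with hf
  set R : ℝ := B * Real.exp (2 * tableAbsSum 𝕊 α * M * Λ * T) with hR
  have hwpos := hw.1
  have hηc : ∀ j k, ContinuousOn (η j k) (Icc 0 T) := fun j k => by
    show ContinuousOn (fun t => X j k t - W j k t) (Icc 0 T); exact (hXc j k).sub (hWc j k)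
  have hΛ : 0 ≤ Λ := le_trans zero_le_one hw.2.1
  have hB0 : 0 ≤ B := le_trans (mul_nonneg (hwpos i n).le (abs_nonneg _)) (hB i n)
  have hR0 : 0 ≤ R := by rw [hR]; positivity
  have hηb : ∀ j k, ∀ t ∈ Icc 0 T, w j k * |η j k t| ≤ R := by
    intro j k t ht
    have h := gauge_abs_sub_le_Icc h𝕊 α hw hXc hWc hX hW hXb hWb hB j k ht
    have hA' := tableAbsSum_nonneg 𝕊 α
    have hM : 0 ≤ M := (abs_nonneg _).trans (hWb j k t ht)
    have hmono : Real.exp (2 * tableAbsSum 𝕊 α * M * Λ * t) ≤ Real.exp (2 * tableAbsSum 𝕊 α * M * Λ * T) :=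
      Real.exp_le_exp.mpr (mul_le_mul_of_nonneg_left ht.2 (by positivity))
    calc w j k * |η j k t| = w j k * |X j k t - W j k t| := rfl
      _ ≤ B * Real.exp (2 * tableAbsSum 𝕊 α * M * Λ * t) := h
      _ ≤ R := by rw [hR]; exact mul_le_mul_of_nonneg_left hmono hB0
  have hfc : ∀ j k, ContinuousOn (f j k) (Icc 0 T) := fun j k => continuousOn_quadTermOn 𝕊 0 α hηc j k
  have hfb : ∀ j k, ∀ t ∈ Icc 0 T, w j k * |f j k t| ≤ tableAbsSum 𝕊 α * A * R ^ 2 := fun j k t ht =>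
    gauge_abs_quadTermOn_le h𝕊 α hwpos hA hR0 fun j' k' _ => hηb j' k' t ht
  have hF : 0 ≤ tableAbsSum 𝕊 α * A * R ^ 2 := by have := tableAbsSum_nonneg 𝕊 α; have := hA.1; positivity
  have hζc : ∀ j k, ContinuousOn (ζ j k) (Icc 0 T) := fun j k => (hηc j k).sub (huc j k)
  have hder : ∀ j k, ∀ t ∈ Ioo 0 T, HasDerivAt (ζ j k) (linTermOn 𝕊 0 α W ζ j k t + f j k t) t := by
    intro j k t ht
    have e1 : quadTermOn 𝕊 0 α X j k t - quadTermOn 𝕊 0 α W j k t =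
        linTermOn 𝕊 0 α W η j k t + quadTermOn 𝕊 0 α η j k t := by
      have hXe : X = W + η := by funext a b c; simp [hη]
      rw [hXe, quadTermOn_add_eq_lin]; ring
    have e2 : linTermOn 𝕊 0 α W ζ j k t = linTermOn 𝕊 0 α W η j k t - linTermOn 𝕊 0 α W u j k t := by
      have hζe : ζ = η + (-1 : ℝ) • u := by funext a b c; simp [hζ]; ring
      rw [hζe, linTermOn_add, linTermOn_smul]; ring
    have hd : HasDerivAt (ζ j k) ((quadTermOn 𝕊 0 α X j k t - quadTermOn 𝕊 0 α W j k t) -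
        linTermOn 𝕊 0 α W u j k t) t := ((hX j k t ht).sub (hW j k t ht)).sub (hu j k t ht)
    refine hd.congr_deriv ?_
    rw [e1, e2, hf]
    ring
  have hζb : ∀ j k, ∀ t ∈ Icc 0 T, |ζ j k t| ≤ 2 * M + Mu := fun j k t ht => by
    have h1 : |η j k t| ≤ 2 * M := by
      show |X j k t - W j k t| ≤ 2 * M
      linarith [abs_sub (X j k t) (W j k t), hXb j k t ht, hWb j k t ht]
    exact (abs_sub _ _).trans (add_le_add h1 (hub j k t ht))
  have hζ0 : ∀ j k, w j k * |ζ j k 0| ≤ 0 := fun j k => by simp [hζ, hη, hu0 j k]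
  have h := gauge_abs_le_forced_exp_Icc h𝕊 α hw hWc hWb hfc hfb hF hζc hder hζb hζ0 i n hs
  rw [zero_add] at h
  calc w i n * |X i n s - W i n s - u i n s| = w i n * |ζ i n s| := rfl
    _ ≤ tableAbsSum 𝕊 α * A * R ^ 2 * s * Real.exp (2 * tableAbsSum 𝕊 α * M * Λ * s) := h

/-! ### Linear ⇒ nonlinear hop estimate on a window -/

/-- **LINEAR ⇒ NONLINEAR HOP ESTIMATE ON A WINDOW** (read-out at `T_r ∈ [0, T]`): as `…NonlinearHop.nonlinear_hop_estimate`,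
with window solutions `W`, `X` on `[0, T]` and the linear hypothesis quantified over window variational solutions
(continuous on `Icc 0 T`, `HasDerivAt` on `Ioo 0 T`, sup-bounded). [cite: Tao2016AveragedNS, §4 (4.8) and §6.3–6.4 (statement shape); route TaoLadderRungTwoFlat, analytic lane L3 on certificate windows] -/
theorem nonlinear_hop_estimate_Icc {𝕊 : Finset (ℤ × ℤ × ℤ)} (h𝕊 : IsNearestNeighbourSet 𝕊)
    (α : Fin m → Fin m → Fin m → ℤ × ℤ × ℤ → ℝ) {w ω : Fin m → ℤ → ℝ} {Λ A Γ : ℝ} (hw : IsWindowRegular w Λ)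
    (hA : IsWindowAdmissible w A) (hω : ∀ i k, 0 ≤ ω i k) {N : ℤ} (hΓ : ∀ i k, ω i k ≤ Γ * w i (k + N))
    {W X : Fin m → ℤ → ℝ → ℝ} {v₁ v₂ : Fin m → ℤ → ℝ} {M T Tr ρ C B B' : ℝ} (hTr : Tr ∈ Icc 0 T)
    (hWc : ∀ i n, ContinuousOn (W i n) (Icc 0 T)) (hXc : ∀ i n, ContinuousOn (X i n) (Icc 0 T))
    (hW : ∀ i n, ∀ t ∈ Ioo 0 T, HasDerivAt (W i n) (quadTermOn 𝕊 0 α W i n t) t)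
    (hX : ∀ i n, ∀ t ∈ Ioo 0 T, HasDerivAt (X i n) (quadTermOn 𝕊 0 α X i n t) t)
    (hWb : ∀ i n, ∀ t ∈ Icc 0 T, |W i n t| ≤ M) (hXb : ∀ i n, ∀ t ∈ Icc 0 T, |X i n t| ≤ M)
    (hlin : ∀ u : Fin m → ℤ → ℝ → ℝ, (∀ i n, ContinuousOn (u i n) (Icc 0 T)) →
      (∀ i n, ∀ t ∈ Ioo 0 T, HasDerivAt (u i n) (linTermOn 𝕊 0 α W u i n t) t) →
      (∃ Mu : ℝ, ∀ i n, ∀ t ∈ Icc 0 T, |u i n t| ≤ Mu) → (∀ i k, ω i k * |u i k 0| ≤ B) →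
        ∃ c₁ c₂ : ℝ, |c₁| ≤ C * B ∧ |c₂| ≤ C * B ∧
          ∀ i k, ω i k * |u i (k + N) Tr - c₁ * v₁ i k - c₂ * v₂ i k| ≤ ρ * B)
    (hB : ∀ i k, ω i k * |X i k 0 - W i k 0| ≤ B) (hB' : ∀ i k, w i k * |X i k 0 - W i k 0| ≤ B') :
    ∃ c₁ c₂ : ℝ, |c₁| ≤ C * B ∧ |c₂| ≤ C * B ∧
      ∀ i k, ω i k * |X i (k + N) Tr - W i (k + N) Tr - c₁ * v₁ i k - c₂ * v₂ i k| ≤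
        ρ * B + Γ * (tableAbsSum 𝕊 α * A * (B' * Real.exp (2 * tableAbsSum 𝕊 α * M * Λ * T)) ^ 2 * Tr *
          Real.exp (2 * tableAbsSum 𝕊 α * M * Λ * Tr)) := by
  have hT : 0 ≤ T := hTr.1.trans hTr.2
  have hd0 : ∀ i k, |(fun i k => X i k 0 - W i k 0) i k| ≤ 2 * max M 0 := by
    intro i k
    have h1 := hXb i k 0 ⟨le_rfl, hT⟩
    have h2 := hWb i k 0 ⟨le_rfl, hT⟩
    have h3 := le_max_left M 0
    calc |X i k 0 - W i k 0| ≤ |X i k 0| + |W i k 0| := abs_sub _ _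
      _ ≤ 2 * max M 0 := by linarith
  obtain ⟨u, hu0, huc, hud, ⟨Mu, hub⟩⟩ := exists_variational_on_window 𝕊 α hT hWc hW hWb hd0
  have hucOn : ∀ i n, ContinuousOn (u i n) (Icc 0 T) := fun i n => (huc i n).continuousOn
  obtain ⟨c₁, c₂, hc₁, hc₂, hlinu⟩ := hlin u hucOn hud ⟨Mu, hub⟩ (fun i k => by rw [hu0]; exact hB i k)
  refine ⟨c₁, c₂, hc₁, hc₂, fun i k => ?_⟩
  have hu0' : ∀ i n, u i n 0 = X i n 0 - W i n 0 := fun i n => hu0 i n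
  have herr := gauge_linearisation_error_Icc h𝕊 α hw hA hWc hXc hW hX hWb hXb hucOn hud hub hu0' hB' i (k + N) hTr
  have hwpos : 0 < w i (k + N) := hw.1 i (k + N)
  have hΓ0 : 0 ≤ Γ := by
    have h := (hω i k).trans (hΓ i k)
    by_contra hneg
    push Not at hneg
    have : Γ * w i (k + N) < 0 := mul_neg_of_neg_of_pos hneg hwpos
    linarith
  have htri : |X i (k + N) Tr - W i (k + N) Tr - c₁ * v₁ i k - c₂ * v₂ i k| ≤
      |u i (k + N) Tr - c₁ * v₁ i k - c₂ * v₂ i k| + |X i (k + N) Tr - W i (k + N) Tr - u i (k + N) Tr| := by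
    have e : X i (k + N) Tr - W i (k + N) Tr - c₁ * v₁ i k - c₂ * v₂ i k =
        (u i (k + N) Tr - c₁ * v₁ i k - c₂ * v₂ i k) + (X i (k + N) Tr - W i (k + N) Tr - u i (k + N) Tr) := by ring
    rw [e]; exact abs_add_le _ _
  have h2 : ω i k * |X i (k + N) Tr - W i (k + N) Tr - u i (k + N) Tr| ≤
      Γ * (tableAbsSum 𝕊 α * A * (B' * Real.exp (2 * tableAbsSum 𝕊 α * M * Λ * T)) ^ 2 * Tr *
        Real.exp (2 * tableAbsSum 𝕊 α * M * Λ * Tr)) := by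
    calc ω i k * |X i (k + N) Tr - W i (k + N) Tr - u i (k + N) Tr|
        ≤ Γ * w i (k + N) * |X i (k + N) Tr - W i (k + N) Tr - u i (k + N) Tr| :=
          mul_le_mul_of_nonneg_right (hΓ i k) (abs_nonneg _)
      _ = Γ * (w i (k + N) * |X i (k + N) Tr - W i (k + N) Tr - u i (k + N) Tr|) := by ring
      _ ≤ _ := mul_le_mul_of_nonneg_left herr hΓ0
  calc ω i k * |X i (k + N) Tr - W i (k + N) Tr - c₁ * v₁ i k - c₂ * v₂ i k|
      ≤ ω i k * (|u i (k + N) Tr - c₁ * v₁ i k - c₂ * v₂ i k| +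
          |X i (k + N) Tr - W i (k + N) Tr - u i (k + N) Tr|) := mul_le_mul_of_nonneg_left htri (hω i k)
    _ = ω i k * |u i (k + N) Tr - c₁ * v₁ i k - c₂ * v₂ i k| +
          ω i k * |X i (k + N) Tr - W i (k + N) Tr - u i (k + N) Tr| := by ring
    _ ≤ _ := add_le_add (hlinu i k) h2

end QuadPolar

end Summit.NavierStokesRegularity.NavierStokesRegularity.Theorems

end
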